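import Summits.ValiantsHypothesis.Statement
import Summits.ValiantsHypothesis.ValiantsHypothesis.Theorems.Depth4HomFourRung
import Literature.Computability.AlgebraicComplexity.SparseCircuitBounds
import HarnessLib

/-!
# Depth4 — the crux is sandwiched on the rate axis (support for `Depth4HomFour`, lens 4, g29)
# `PerRateHard(√n·log n) ⟹ Depth4HomFour ⟹ VH`

Crux `Depth4HomFour` (item `stmt-ValiantsHypothesis-11333`) asks, in the measure
`homDepthFourCircuitSize` (GATES of homogeneous `ΣΠΣΠ` circuits of unbounded fan-in), for
`∀ c, ∃ n, (n+2 : ℕ∞)^(c * Nat.sqrt n + c) < homDepthFourCircuitSize (perPoly (Fin n) ℂ)`.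
The route's `closes` (equivalently `Depth4SizeCoupling.vh_of_balanced_rungs`) is the DOWNWARD
arrow `Depth4HomFour ⟹ VH`, whose loss is the chasm (`√d` in the exponent).  This file proves
the UPWARD arrow: fan-in-two hardness of `per_n` at rate `√n · log n`,
`∀ c, ∃ n, (n+2)^(c * Nat.sqrt n + c) < complexity (perPoly (Fin n) ℂ)`, implies the crux AT
THE SAME `n`, losing only the factor `3` (`+12`) in the exponent (`depth4HomFour_of_perRateHard`,
pointwise `homDepthFour_perPoly_gt_of_complexity_gt`).  So, in the kernel,
`(∀ c ∃ n, (n+2)^(c⌊√n⌋+c) < L(per_n)) ⟹ Depth4HomFour ⟹ (∀ a ∃ n, (n+2)^a < L(per_n)) = VH`,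
the two losses being asymmetric (up: a constant factor; down: the chasm).

Mechanism (§1, any commutative ring) = the GATE twin of generation 28's wire rebuild: the
Kumar–Saraf normal form `f = ∑_q c_q ∏_j Q_{qj}` (`ArithCircuit.exists_sum_prod`, `≤ s` terms,
constants folded into `c_q`, `≤ d` positive-degree bottom factors per term, each a sum of
`≤ s + N + 1` monomials of degree `≤ d` by `Depth4HomFourRung.card_support_le_of_isBottomFactor`)
priced by the tree's complexity algebra (`complexity_finset_sum_le`, `complexity_finset_prod_le`,
`complexity_le_card_support_mul`, `complexity_smul_le`, `complexity_mul_le`, `complexity_C`):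
`complexity f ≤ ((s + N + 1)(d + 2))³` fan-in-two gates (`complexity_le_of_homDepthFour`) — pure
algebra, no circuit surgery.  §2 specialises to `per_n` (`N = n²`, `d = n`; `n ≤ 1` is vacuous).

HONEST GRADE.  Mathematics known/folklore (the easy direction of the chasm: a homogeneous `ΣΠΣΠ`
circuit is a circuit, modulo the gates-versus-fan-in-two convention settled by the normal form
and sparsity); kernel-new; a PLACEMENT of the crux (census C1 relation field), not a rung: the
hypothesis `PerRateHard(√n·log n)` is itself at least `VH` (`vh_of_perRateHard`) and open.
Helper of `stmt-ValiantsHypothesis-11333`; 0 S-currency; closes no item; `VP ≠ VNP` untouched.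
Sorry-free, no `def`; Theses not imported (`depth4HomFour_of_perRateHard` concludes the crux
body verbatim).  [cite: KumarSaraf2017, §3 eq. (3.1)] [cite: Burgisser2000, §2.1]
[cite: Tavenas2015, Thm. 1] (downward arrow, quoted for the sandwich only) [cite: Valiant1979]
-/

set_option linter.dupNamespace false

noncomputable section

open MvPolynomial
open Literature.Computability.AlgebraicComplexity
open Summit.ValiantsHypothesis.ValiantsHypothesis.Theorems.Depth4HomFourRung
  (card_support_le_of_isBottomFactor exists_circuit_of_homDepthFourCircuitSize_le)

namespace Summit.ValiantsHypothesis.ValiantsHypothesis.Theorems.Depth4HomFourSandwich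

/-! ### §1 Gates of a homogeneous `ΣΠΣΠ` circuit → fan-in-two gates -/
section GateNormalForm

variable {K : Type} [CommRing K] {σ : Type} [Fintype σ] [DecidableEq σ]

/-- Gate bookkeeping of the normal form: `Qc·T + Qc ≤ ((s+N+1)(d+2))³`. [folklore] -/
theorem gates_bound {s N d Qc T : ℕ} (hQ : Qc ≤ s)
    (hT : T ≤ d * ((s + (N + 1)) * (2 * d + 2)) + d + 3) :
    Qc * T + Qc ≤ ((s + N + 1) * (d + 2)) ^ 3 := by
  have hX : 1 ≤ s + N + 1 := by omega
  have hQX : Qc ≤ s + N + 1 := by omega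
  have hre : d * ((s + (N + 1)) * (2 * d + 2)) = (s + N + 1) * (2 * d * d + 2 * d) := by ring
  have hT1 : T + 1 ≤ (s + N + 1) * (2 * d * d + 3 * d + 4) := by
    have h1 : d + 4 ≤ (s + N + 1) * (d + 4) := Nat.le_mul_of_pos_left _ (by omega)
    calc T + 1 ≤ d * ((s + (N + 1)) * (2 * d + 2)) + (d + 4) := by omega
      _ = (s + N + 1) * (2 * d * d + 2 * d) + (d + 4) := by rw [hre]
      _ ≤ (s + N + 1) * (2 * d * d + 2 * d) + (s + N + 1) * (d + 4) :=
          Nat.add_le_add_left h1 _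
      _ = (s + N + 1) * (2 * d * d + 3 * d + 4) := by ring
  have hY : 2 * d * d + 3 * d + 4 ≤ (d + 2) ^ 3 := (Nat.le_add_left _ _).trans_eq
    (show d * d * d + 4 * (d * d) + 9 * d + 4 + (2 * d * d + 3 * d + 4) = (d + 2) ^ 3 by ring)
  calc Qc * T + Qc = Qc * (T + 1) := by ring
    _ ≤ (s + N + 1) * ((s + N + 1) * (2 * d * d + 3 * d + 4)) := Nat.mul_le_mul hQX hT1
    _ ≤ (s + N + 1) * ((s + N + 1) * (d + 2) ^ 3) :=
        Nat.mul_le_mul_left _ (Nat.mul_le_mul_left _ hY)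
    _ ≤ (s + N + 1) * ((s + N + 1) * (d + 2) ^ 3) * (s + N + 1) :=
        Nat.le_mul_of_pos_right _ (by omega)
    _ = ((s + N + 1) * (d + 2)) ^ 3 := by ring

/-- **Gate normal form of homogeneous `ΣΠΣΠ` circuits**: a homogeneous depth-4 circuit `P`
(unbounded fan-in, `size` = gates) for `f`, homogeneous of degree `d ≥ 2`, yields
`complexity f ≤ ((size P + #σ + 1)·(d + 2))³` (fan-in-two gates), by pricing the Kumar–Saraf
normal form `ArithCircuit.exists_sum_prod`. [cite: KumarSaraf2017, §3 eq. (3.1)]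
[cite: Burgisser2000, §2.1] -/
theorem complexity_le_of_homDepthFour {P : ArithCircuit K σ} {f : MvPolynomial σ K} {d : ℕ}
    (hc : P.Computes f) (h4 : P.IsDepthFour) (hh : P.IsHomogeneousCircuit)
    (hf : f.IsHomogeneous d) (hd : 2 ≤ d) :
    complexity f ≤ ((P.size + Fintype.card σ + 1) * (d + 2)) ^ 3 := by
  classical
  rcases subsingleton_or_nontrivial K with hK | hK
  · rw [show f = C 0 from MvPolynomial.ext _ _ fun m => Subsingleton.elim _ _, complexity_C_holds]
    exact Nat.zero_le _
  -- the normal form `f = ∑_{q ∈ Q} c_q • q`, `q = ∏_j g_{qj}` (as in `Depth4HomFourRung`)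
  obtain ⟨Q, c, hQcard, hfsum, hQ⟩ := ArithCircuit.exists_sum_prod hc h4 hh hf hd
  choose L hL hqL using fun q : ↥Q => (hQ q.1 q.2).2.2
  obtain ⟨g, hg⟩ : ∃ g : (q : ↥Q) → Fin (L q).length → MvPolynomial σ K,
      ∀ q j, g q j = (L q).get j := ⟨_, fun _ _ => rfl⟩
  have hprod : ∀ q : ↥Q, (q : MvPolynomial σ K) = ∏ j, g q j := fun q => by
    rw [hqL q]; simp only [hg, List.get_eq_getElem, Fin.prod_univ_getElem]
  have hL' : ∀ (q : ↥Q) (j : Fin (L q).length),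
      P.IsBottomFactor (g q j) ∧ ∃ e, (g q j).IsHomogeneous e := fun q j =>
    hL q _ (by rw [hg]; exact List.get_mem _ _)
  have hne : ∀ (q : ↥Q) (j : Fin (L q).length), g q j ≠ 0 := fun q j h0 =>
    (hQ q.1 q.2).1 (by rw [hprod q]; exact Finset.prod_eq_zero (Finset.mem_univ j) h0)
  have hhom : ∀ (q : ↥Q) (j : Fin (L q).length), (g q j).IsHomogeneous (g q j).totalDegree :=
    fun q j => by obtain ⟨e, he⟩ := (hL' q j).2; rwa [he.totalDegree (hne q j)]
  have hdeg : ∀ q : ↥Q, ∑ j, (g q j).totalDegree = d := fun q => by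
    have h1 : (q : MvPolynomial σ K).IsHomogeneous (∑ j, (g q j).totalDegree) := by
      rw [hprod q]
      exact IsHomogeneous.prod _ _ _ fun j _ => hhom q j
    exact h1.inj_right (hQ q.1 q.2).2.1 (hQ q.1 q.2).1
  have hdegle : ∀ (q : ↥Q) (j : Fin (L q).length), (g q j).totalDegree ≤ d := fun q j => by
    rw [← hdeg q]
    exact Finset.single_le_sum (f := fun j => (g q j).totalDegree) (fun _ _ => Nat.zero_le _)
      (Finset.mem_univ j)
  -- at most `d` factors of positive degree per term
  have hcardS : ∀ q : ↥Q,
      Fintype.card {j : Fin (L q).length // 0 < (g q j).totalDegree} ≤ d := fun q => by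
    rw [Fintype.card_subtype, Finset.card_eq_sum_ones, ← hdeg q]
    have h1 : ∑ _j ∈ Finset.univ.filter (fun j : Fin (L q).length => 0 < (g q j).totalDegree), 1
        ≤ ∑ j ∈ Finset.univ.filter (fun j : Fin (L q).length => 0 < (g q j).totalDegree),
          (g q j).totalDegree :=
      Finset.sum_le_sum fun j hj => Nat.one_le_of_lt (Finset.mem_filter.mp hj).2
    exact h1.trans (Finset.sum_le_sum_of_subset (Finset.filter_subset _ _))
  -- the constant factors fold into one constant `z_q`
  obtain ⟨z, hz⟩ : ∃ z : ↥Q → K, ∀ q, z q =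
      ∏ j ∈ Finset.univ.filter (fun j : Fin (L q).length => ¬ 0 < (g q j).totalDegree),
        coeff 0 (g q j) := ⟨_, fun _ => rfl⟩
  have hsplit : ∀ q : ↥Q, (q : MvPolynomial σ K) =
      (∏ j : {j : Fin (L q).length // 0 < (g q j).totalDegree}, g q j.1) * C (z q) := by
    intro q
    rw [hprod q, ← Finset.prod_filter_mul_prod_filter_not Finset.univ
      (fun j : Fin (L q).length => 0 < (g q j).totalDegree)]
    congr 1
    · exact Finset.prod_subtype _ (fun j => by simp) _
    · rw [hz q, map_prod]
      exact Finset.prod_congr rfl fun j hj =>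
        totalDegree_eq_zero_iff_eq_C.mp (Nat.eq_zero_of_not_pos (Finset.mem_filter.mp hj).2)
  -- pricing: a bottom factor is a sum of `≤ s + N + 1` monomials of degree `≤ d`
  have hfac : ∀ (q : ↥Q) (j : Fin (L q).length),
      complexity (g q j) ≤ (P.size + (Fintype.card σ + 1)) * (2 * d + 2) := fun q j =>
    (complexity_le_card_support_mul _).trans (Nat.mul_le_mul
      (card_support_le_of_isBottomFactor (hL' q j).1) (by have := hdegle q j; omega))
  -- pricing of one term `c_q • (∏_{deg > 0} g_{qj} * C z_q)`
  have hterm : ∀ q : ↥Q, complexity (c q • (q : MvPolynomial σ K)) ≤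
      d * ((P.size + (Fintype.card σ + 1)) * (2 * d + 2)) + d + 3 := fun q => by
    have hπ : complexity (∏ j : {j : Fin (L q).length // 0 < (g q j).totalDegree}, g q j.1)
        ≤ d * ((P.size + (Fintype.card σ + 1)) * (2 * d + 2)) + d := by
      refine (complexity_finset_prod_le _ _).trans ?_
      rw [Finset.card_univ]
      refine Nat.add_le_add ((Finset.sum_le_sum fun j _ => hfac q j.1).trans ?_) (hcardS q)
      rw [Finset.sum_const, smul_eq_mul, Finset.card_univ]
      exact Nat.mul_le_mul_right _ (hcardS q)
    have h1 := complexity_smul_le_holds (c q) (q : MvPolynomial σ K)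
    have h2 := complexity_mul_le_holds
      (∏ j : {j : Fin (L q).length // 0 < (g q j).totalDegree}, g q j.1) (C (z q))
    rw [← hsplit q, complexity_C_holds] at h2
    omega
  -- pricing of the outer sum
  rw [hfsum, ← Finset.sum_coe_sort Q]
  refine (complexity_finset_sum_le _ _).trans ?_
  have hsum : ∑ q : ↥Q, complexity (c q • (q : MvPolynomial σ K)) ≤
      Fintype.card ↥Q * (d * ((P.size + (Fintype.card σ + 1)) * (2 * d + 2)) + d + 3) :=
    (Finset.sum_le_sum fun q _ => hterm q).trans
      (by rw [Finset.sum_const, smul_eq_mul, Finset.card_univ])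
  rw [Finset.card_univ]
  exact (Nat.add_le_add_right hsum _).trans
    (gates_bound (by rw [Fintype.card_coe]; exact hQcard) le_rfl)

/-- The same from a finite bound on the door measure `homDepthFourCircuitSize f` (extraction
`Depth4HomFourRung.exists_circuit_of_homDepthFourCircuitSize_le`). [cite: KumarSaraf2017, §3] -/
theorem complexity_le_of_homDepthFourCircuitSize_le {f : MvPolynomial σ K} {d s : ℕ}
    (hf : f.IsHomogeneous d) (hd : 2 ≤ d) (h : homDepthFourCircuitSize f ≤ (s : ℕ∞)) :
    complexity f ≤ ((s + Fintype.card σ + 1) * (d + 2)) ^ 3 := by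
  obtain ⟨P, hPc, hP4, hPh, hPs⟩ := exists_circuit_of_homDepthFourCircuitSize_le h
  exact (complexity_le_of_homDepthFour hPc hP4 hPh hf hd).trans
    (Nat.pow_le_pow_left (Nat.mul_le_mul_right _ (by omega)) 3)

/-- Contrapositive, pointwise: fan-in-two hardness beyond the cube forces the door measure
above `s`. [cite: KumarSaraf2017, §3] -/
theorem lt_homDepthFourCircuitSize_of_lt_complexity {f : MvPolynomial σ K} {d s : ℕ}
    (hf : f.IsHomogeneous d) (hd : 2 ≤ d)
    (h : ((s + Fintype.card σ + 1) * (d + 2)) ^ 3 < complexity f) :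
    (s : ℕ∞) < homDepthFourCircuitSize f :=
  lt_of_not_ge fun hle => (not_le.2 h) (complexity_le_of_homDepthFourCircuitSize_le hf hd hle)

end GateNormalForm

/-! ### §2 The permanent: the upward arrow and the sandwich -/
/-- Exponent bookkeeping: `(((n+2)^(c⌊√n⌋+c) + n² + 1)(n+2))³ ≤ (n+2)^((3c+12)⌊√n⌋ + (3c+12))`.
[folklore] -/
theorem rate_arith (c n : ℕ) :
    (((n + 2) ^ (c * Nat.sqrt n + c) + n * n + 1) * (n + 2)) ^ 3 ≤
      (n + 2) ^ ((3 * c + 12) * Nat.sqrt n + (3 * c + 12)) := by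
  have h2 : 0 < n + 2 := by omega
  have hA : n * n + 1 ≤ (n + 2) ^ (c * Nat.sqrt n + c + 2) :=
    calc n * n + 1 ≤ (n + 2) ^ 2 := by nlinarith
      _ ≤ (n + 2) ^ (c * Nat.sqrt n + c + 2) := Nat.pow_le_pow_right h2 (by omega)
  have hB : (n + 2) ^ (c * Nat.sqrt n + c) ≤ (n + 2) ^ (c * Nat.sqrt n + c + 2) :=
    Nat.pow_le_pow_right h2 (by omega)
  have hX : ((n + 2) ^ (c * Nat.sqrt n + c) + n * n + 1) * (n + 2) ≤
      2 * (n + 2) ^ (c * Nat.sqrt n + c + 2) * (n + 2) :=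
    Nat.mul_le_mul_right _ (by omega)
  have h8 : 8 ≤ (n + 2) ^ 3 := by simpa using Nat.pow_le_pow_left (show 2 ≤ n + 2 by omega) 3
  have hexp : 3 * (c * Nat.sqrt n + c) + 12 ≤ (3 * c + 12) * Nat.sqrt n + (3 * c + 12) := by
    nlinarith [Nat.zero_le (Nat.sqrt n), Nat.zero_le c]
  calc (((n + 2) ^ (c * Nat.sqrt n + c) + n * n + 1) * (n + 2)) ^ 3
      ≤ (2 * (n + 2) ^ (c * Nat.sqrt n + c + 2) * (n + 2)) ^ 3 := Nat.pow_le_pow_left hX 3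
    _ = 8 * (n + 2) ^ (3 * (c * Nat.sqrt n + c) + 9) := by ring
    _ ≤ (n + 2) ^ 3 * (n + 2) ^ (3 * (c * Nat.sqrt n + c) + 9) := Nat.mul_le_mul_right _ h8
    _ = (n + 2) ^ (3 * (c * Nat.sqrt n + c) + 12) := by ring
    _ ≤ (n + 2) ^ ((3 * c + 12) * Nat.sqrt n + (3 * c + 12)) := Nat.pow_le_pow_right h2 hexp

/-- `per_0 = 1` and `per_1 = x₀₀` are cheap: `complexity per_n ≤ 8` for `n ≤ 1`
(`complexity_le_pow_card`). [folklore] -/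
theorem complexity_perPoly_le_of_le_one {n : ℕ} (hn : n ≤ 1) :
    complexity (perPoly (Fin n) ℂ) ≤ 8 := by
  have hdeg : (perPoly (Fin n) ℂ).totalDegree ≤ 1 :=
    (perPoly_isHomogeneous (n := Fin n) (k := ℂ)).totalDegree_le.trans (by simpa using hn)
  have hcard : Fintype.card (Fin n × Fin n) ≤ 1 := by
    rw [Fintype.card_prod, Fintype.card_fin]
    nlinarith
  calc complexity (perPoly (Fin n) ℂ)
      ≤ ((perPoly (Fin n) ℂ).totalDegree + 1) ^ Fintype.card (Fin n × Fin n) *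
          (2 * (perPoly (Fin n) ℂ).totalDegree + 2) := complexity_le_pow_card _
    _ ≤ 2 ^ 1 * 4 := Nat.mul_le_mul ((Nat.pow_le_pow_left (by omega) _).trans
          (Nat.pow_le_pow_right (by norm_num) hcard)) (by omega)
    _ = 8 := by norm_num

/-- **The upward arrow, pointwise in `n`**: `L(per_n) > (n+2)^((3c+12)⌊√n⌋+(3c+12))`
(fan-in-two gates) gives `homDepthFourCircuitSize per_n > (n+2)^(c⌊√n⌋+c)` at the SAME `n`,
route `Depth4`'s exact currency. [cite: KumarSaraf2017, §3] -/
theorem homDepthFour_perPoly_gt_of_complexity_gt (c n : ℕ)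
    (h : (n + 2) ^ ((3 * c + 12) * Nat.sqrt n + (3 * c + 12)) < complexity (perPoly (Fin n) ℂ)) :
    ((n + 2 : ℕ∞) ^ (c * Nat.sqrt n + c)) < homDepthFourCircuitSize (perPoly (Fin n) ℂ) := by
  classical
  have hbig : 8 < (n + 2) ^ ((3 * c + 12) * Nat.sqrt n + (3 * c + 12)) :=
    calc 8 < 2 ^ 12 := by norm_num
      _ ≤ (n + 2) ^ ((3 * c + 12) * Nat.sqrt n + (3 * c + 12)) := (Nat.pow_le_pow_left
          (by omega) 12).trans (Nat.pow_le_pow_right (by omega) (le_add_left (by omega)))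
  have hn2 : 2 ≤ n := by
    by_contra hlt
    exact (not_lt.2 (complexity_perPoly_le_of_le_one (n := n) (by omega))) (hbig.trans h)
  refine lt_of_not_ge fun hlt => ?_
  have hle : homDepthFourCircuitSize (perPoly (Fin n) ℂ) ≤
      (((n + 2) ^ (c * Nat.sqrt n + c) : ℕ) : ℕ∞) := by exact_mod_cast hlt
  have hper : (perPoly (Fin n) ℂ).IsHomogeneous n := by
    simpa using perPoly_isHomogeneous (n := Fin n) (k := ℂ)
  have hc := complexity_le_of_homDepthFourCircuitSize_le hper hn2 hle
  have hcard : Fintype.card (Fin n × Fin n) = n * n := by simp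
  rw [hcard] at hc
  exact absurd (hc.trans (rate_arith c n)) (not_le.2 h)

/-- **`PerRateHard(√n) ⟹ Depth4HomFour`** (the conclusion is the body of crux
`Theses.Depth4.Depth4HomFour` verbatim): if for every `c` some `per_n` needs more than
`(n+2)^(c⌊√n⌋+c)` fan-in-two gates, then for every `c` some `per_n` needs more than
`(n+2)^(c⌊√n⌋+c)` gates in every homogeneous `ΣΠΣΠ` circuit. [cite: KumarSaraf2017, §3] -/
theorem depth4HomFour_of_perRateHard
    (h : ∀ c : ℕ, ∃ n : ℕ, (n + 2) ^ (c * Nat.sqrt n + c) < complexity (perPoly (Fin n) ℂ)) :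
    ∀ c : ℕ, ∃ n : ℕ,
      ((n + 2 : ℕ∞) ^ (c * Nat.sqrt n + c)) < homDepthFourCircuitSize (perPoly (Fin n) ℂ) :=
  fun c => (h (3 * c + 12)).imp fun n hn => homDepthFour_perPoly_gt_of_complexity_gt c n hn

/-- The same with thresholds (`∃ n ≥ m₀` on both sides). [cite: KumarSaraf2017, §3] -/
theorem depth4HomFour_io_of_perRateHard_io
    (h : ∀ c m₀ : ℕ, ∃ n : ℕ, m₀ ≤ n ∧
      (n + 2) ^ (c * Nat.sqrt n + c) < complexity (perPoly (Fin n) ℂ)) :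
    ∀ c m₀ : ℕ, ∃ n : ℕ, m₀ ≤ n ∧
      ((n + 2 : ℕ∞) ^ (c * Nat.sqrt n + c)) < homDepthFourCircuitSize (perPoly (Fin n) ℂ) :=
  fun c m₀ => (h (3 * c + 12) m₀).imp fun n hn =>
    ⟨hn.1, homDepthFour_perPoly_gt_of_complexity_gt c n hn.2⟩

/-- The outer frame of the sandwich: `PerRateHard(√n)` is itself at least `VH`
(`L(per_n) ≤ n^a + a ≤ 2(n+2)^a ≤ (n+2)^(a+1)`). [cite: Burgisser2000, Thm. 2.10]
[cite: Valiant1979] -/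
theorem vh_of_perRateHard
    (h : ∀ c : ℕ, ∃ n : ℕ, (n + 2) ^ (c * Nat.sqrt n + c) < complexity (perPoly (Fin n) ℂ)) :
    _root_.ValiantsHypothesis := by
  show VP ℂ ≠ VNP ℂ
  intro hEq
  have hVP : perFamily ℂ ∈ VP ℂ := by rw [hEq]; exact perFamily_mem_VNP_holds ℂ
  obtain ⟨-, a, ha⟩ : IsVPFamily (fun n => perPoly (Fin n) ℂ) :=
    (mem_VP_ofFintype_iff_holds _).1 hVP
  obtain ⟨n, hlt⟩ := h (a + 1)
  have hs : complexity (perPoly (Fin n) ℂ) ≤ (n + 2) ^ ((a + 1) * Nat.sqrt n + (a + 1)) :=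
    calc complexity (perPoly (Fin n) ℂ)
        ≤ 2 * (n + 2) ^ a := DepthReduction.le_two_mul_pow (ha n) le_rfl
      _ ≤ (n + 2) * (n + 2) ^ a := Nat.mul_le_mul_right _ (by omega)
      _ = (n + 2) ^ (a + 1) := by ring
      _ ≤ (n + 2) ^ ((a + 1) * Nat.sqrt n + (a + 1)) :=
          Nat.pow_le_pow_right (by omega) (Nat.le_add_left _ _)
  exact absurd hlt (not_lt.2 hs)

end Summit.ValiantsHypothesis.ValiantsHypothesis.Theorems.Depth4HomFourSandwich

end
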